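import Summits.NavierStokesRegularity.NavierStokesRegularity.Theorems.TypeICertificateLadderTargetDepletionLocalConcentration
import Summits.NavierStokesRegularity.NavierStokesRegularity.Theorems.TypeICertificateLadderTargetFlowwiseDepletionSlice
import HarnessLib

/-!
# Crux `Target` = `TypeICertificateLadder.NoTypeIBlowup` (stmt-NavierStokesRegularity-1217), line
# `depletion-ladder`: LOCAL CONCENTRATION IS AN ABSOLUTE ENSTROPHY-DISSIPATION CREDIT (slice form)

`--supports stmt-NavierStokesRegularity-1217` (fifth file of the seat's S1-structure series; consumer of
`…TargetDepletionLocalConcentration.lean` and of the slice machinery of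
`…TargetFlowwiseDepletionSlice.lean`).

The enstrophy slice identity `½ d/dt ‖ω‖₂² = ∫⟪ω, curl ∂ₜu⟫ = −ν‖∇ω‖₂² + ∫⟪ω, Du ω⟫` is usually
closed by Cauchy–Schwarz and Young: `≤ (M²/(4ν))‖ω‖₂²` (`M = sup|u|`), the `q = 2` budget whose
Grönwall exponent is rung one's `C²/2`. The direction-defect law `J² ≤ M²‖ω‖₂²(‖∇ω‖₂² − ∫(û·curl ω)²)`
and the LOCAL Cauchy–Schwarz `(∫φ⟪u, curl ω⟫)² ≤ E_φ ∫(û·curl ω)²` (local energy `E_φ = ∫φ²|u|²`)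
improve the Young step by an ABSOLUTE amount, independent of the unknown palinstrophy `‖∇ω‖₂²`:

* `enstrophy_slice_le_sub_localConcentration` — `v` smooth divergence free, `|v| ≤ M`, `‖Dv‖ ≤ B`,
  `Dv, D²v, D³v ∈ L²`, `curl W = νΔω − (v·∇)ω + (ω·∇)v` (`ω = curl v`), `φ ∈ C¹_c`:
  `∫⟪ω, curl W⟫ ≤ (M²/(4ν)) ‖ω‖₂² − ν · (∫φ⟪v, curl ω⟫)²/E_φ`,
  where by the localized alignment identity (`integral_mul_inner_curl_curl_eq`)
  `∫φ⟪v, curl ω⟫ = ∫φ‖ω‖² − ∫⟪v, ∇φ × ω⟫` = (enstrophy captured by `φ`) − (flux through the cut-off).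

Consequence for the crux (recorded, not formalised here): along a Type-I flow
(`M² = C²ν/(T−t)`), with `φ` a cut-off of a ball of radius `λ√(ν(T−t))` capturing the fraction `θ`
of the enstrophy (net of flux), `E_φ ≤ C²λ³|B₁|ν^{5/2}(T−t)^{1/2}` and the slice inequality reads
`Z' ≤ C²Z/(2(T−t)) − (2θ²/(C²λ³|B₁|ν^{3/2})) Z²(T−t)^{−1/2}` — a LOGISTIC law for
`y = Z√(T−t)/ν^{3/2}`: `dy/ds ≤ ½(C²−1)y − (2θ²/(C²λ³|B₁|))y²` (`s = −log(T−t)`), capping `y`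
at `y* = (C²−1)C²λ³|B₁|/(4θ²)`; Leray's `H¹` rate `y ≥ c` then excludes the singularity whenever
`(C²−1)C²λ³|B₁| < 4cθ²`. Uniform ENSTROPHY CONFINEMENT at the parabolic scale is thus a lever on
the ladder with no built-in ceiling in `C` (cf. the `√6−√2` ceiling of every `L^q` budget,
`RungReynoldsOneNegative.lt_ceiling_of_budgetCloses`) — and it is the typed "What is missing" of the
seat's census (no such confinement is in print; Barker–Prange 2020 Thm 2 concentrates `L³`
non-quantitatively). The slab/ODE step can reuse the landed logistic barrier
`DepletionLadder.le_max_of_logistic_integral_ineq` (…TargetLogisticBarrier.lean).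

WHAT THIS IS NOT: no confinement and no rung is proved; a one-time budget with a new negative term.
[folklore]
-/

noncomputable section

open Set Function Filter Topology MeasureTheory
open scoped RealInnerProductSpace ENNReal NNReal Laplacian ContDiff
open Literature.Analysis.FluidPDE

namespace Summit.NavierStokesRegularity.NavierStokesRegularity.Theorems.DepletionLadder

-- the problem directory repeats the summit name (`NavierStokesRegularity/NavierStokesRegularity`)
set_option linter.dupNamespace false

open Summit.NavierStokesRegularity.NavierStokesRegularity.Theorems.RungReynoldsOne
open Summit.NavierStokesRegularity.NavierStokesRegularity.Theorems.RungReynoldsOne.WeightedSlice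
open Summit.NavierStokesRegularity.NavierStokesRegularity.Theorems.SimilarityEnstrophy

/-- **The enstrophy slice inequality with the local-concentration credit.** Let `v` be smooth and
divergence free with `ω = curl v`, `|v| ≤ M`, `‖Dv‖ ≤ B`, `Dv, D²v, D³v ∈ L²`, let `W` satisfy the
vorticity equation `curl W = νΔω − (v·∇)ω + (ω·∇)v`, and let `φ` be a compactly supported `C¹`
weight. Then `∫⟪ω, curl W⟫ ≤ (M²/(4ν)) ∫‖ω‖² − ν (∫φ⟪v, curl ω⟫)² / ∫φ²‖v‖²` (`x/0 = 0`):
viscosity `−ν‖∇ω‖₂²`, transport `0`, stretching `J ≤ M‖ω‖₂ √(‖∇ω‖₂² − q)` with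
`q = (∫φ⟪v, curl ω⟫)²/E_φ ≤ ∫(v̂·curl ω)²` (direction-defect law + local Cauchy–Schwarz), and Young on
`‖∇ω‖₂² − q`. [folklore] -/
theorem enstrophy_slice_le_sub_localConcentration {ν : ℝ} (hν : 0 < ν)
    {v W : EuclideanSpace ℝ (Fin 3) → EuclideanSpace ℝ (Fin 3)} (hv : ContDiff ℝ ∞ v)
    (hdiv : VectorCalculus.IsDivFree v)
    (hcurl : ∀ x, curl W x = ν • (Δ (curl v)) x - convect v (curl v) x + convect (curl v) v x)
    {M B : ℝ} (hM : ∀ x, ‖v x‖ ≤ M) (hB : ∀ x, ‖fderiv ℝ v x‖ ≤ B)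
    (h1 : ∫⁻ x, ‖iteratedFDeriv ℝ 1 v x‖ₑ ^ 2 < ⊤) (h2 : ∫⁻ x, ‖iteratedFDeriv ℝ 2 v x‖ₑ ^ 2 < ⊤)
    (h3 : ∫⁻ x, ‖iteratedFDeriv ℝ 3 v x‖ₑ ^ 2 < ⊤)
    {φ : EuclideanSpace ℝ (Fin 3) → ℝ} (hφ : ContDiff ℝ 1 φ) (hcφ : HasCompactSupport φ) :
    ∫ x, ⟪curl v x, curl W x⟫ ≤
      M ^ 2 / (4 * ν) * (∫ x, ‖curl v x‖ ^ 2) -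
        ν * ((∫ x, φ x * ⟪v x, curl (curl v) x⟫) ^ 2 / ∫ x, φ x ^ 2 * ‖v x‖ ^ 2) := by
  set e := EuclideanSpace.basisFun (Fin 3) ℝ with he
  have he1 : ∀ i, ‖e i‖ = 1 := fun i => by simp [he]
  -- smoothness of the vorticity
  have hDv : ContDiff ℝ ∞ (fderiv ℝ v) := (contDiff_infty_iff_fderiv.1 hv).2
  have hω : ContDiff ℝ ∞ (curl v) := by
    rw [curl_eq_curlCLM_comp]
    exact curlCLM.contDiff.comp hDv
  have hω2 : ContDiff ℝ 2 (curl v) := hω.of_le (by norm_cast)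
  have hω1 : ContDiff ℝ 1 (curl v) := hω.of_le (by norm_cast)
  have hv1 : ContDiff ℝ 1 v := hv.of_le (by norm_cast)
  have hv2 : ContDiff ℝ 2 v := hv.of_le (by norm_cast)
  have cv : Continuous v := hv.continuous
  have cω : Continuous (curl v) := hω.continuous
  -- the vorticity equation with `convect` unfolded
  have hZ : ∀ x, curl W x =
      ν • (Δ (curl v)) x - fderiv ℝ (curl v) x (v x) + fderiv ℝ v x (curl v x) := hcurl
  -- `ω, ∂ᵢω, ∂ᵢ∂ᵢω ∈ L²`
  have l2ω : ∫⁻ x, ‖curl v x‖ₑ ^ 2 < ⊤ := by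
    refine lintegral_enorm_sq_lt_top_of_norm_le_const_mul ‖curlCLM‖ (fun x => ?_) h1
    rw [← norm_iteratedFDeriv_fderiv, norm_iteratedFDeriv_zero]
    exact norm_curl_le v x
  have l2dω : ∀ i, ∫⁻ x, ‖fderiv ℝ (curl v) x (e i)‖ₑ ^ 2 < ⊤ := fun i => by
    refine lintegral_enorm_sq_lt_top_of_norm_le_const_mul ‖curlCLM‖ (fun x => ?_) h2
    calc ‖fderiv ℝ (curl v) x (e i)‖ ≤ ‖fderiv ℝ (curl v) x‖ := by
          simpa [he1] using (fderiv ℝ (curl v) x).le_opNorm (e i)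
      _ ≤ ‖curlCLM‖ * ‖iteratedFDeriv ℝ 2 v x‖ := norm_fderiv_curl_le hv2 x
  have l2ddω : ∀ i, ∫⁻ x, ‖fderiv ℝ (fun y => fderiv ℝ (curl v) y (e i)) x (e i)‖ₑ ^ 2 < ⊤ :=
      fun i => by
    refine lintegral_enorm_sq_lt_top_of_norm_le_const_mul ‖curlCLM‖ (fun x => ?_) h3
    calc ‖fderiv ℝ (fun y => fderiv ℝ (curl v) y (e i)) x (e i)‖
        ≤ ‖iteratedFDeriv ℝ 2 (curl v) x‖ := norm_fderiv_fderiv_apply_basisFun_le hω2 x i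
      _ ≤ ‖curlCLM‖ * ‖iteratedFDeriv ℝ 3 v x‖ := by
          rw [curl_eq_curlCLM_comp, curlCLM.iteratedFDeriv_comp_left (hDv.contDiffAt (x := x))
            (i := 2) (by norm_cast), ← norm_iteratedFDeriv_fderiv]
          exact ContinuousLinearMap.norm_compContinuousMultilinearMap_le _ _
  -- the three terms
  obtain ⟨iLap, iFrob, hVisc⟩ := enstrophy_viscous hω2 l2ω l2dω l2ddω
  obtain ⟨iTr, hTr⟩ := enstrophy_transport hv1 hω2 hdiv hM hB l2ω l2dω
  have iStr : Integrable (fun x => ⟪curl v x, fderiv ℝ v x (curl v x)⟫) volume := by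
    refine integrable_of_norm_le_const_mul_mul B
      (cω.inner ((hv1.continuous_fderiv one_ne_zero).clm_apply cω)) cω cω l2ω l2ω fun x => ?_
    calc ‖⟪curl v x, fderiv ℝ v x (curl v x)⟫‖ ≤ ‖curl v x‖ * ‖fderiv ℝ v x (curl v x)‖ :=
          norm_inner_le_norm _ _
      _ ≤ ‖curl v x‖ * (B * ‖curl v x‖) :=
          mul_le_mul_of_nonneg_left ((fderiv ℝ v x).le_of_opNorm_le (hB x) _) (norm_nonneg _)
      _ = B * ‖curl v x‖ * ‖curl v x‖ := by ring
  set Z : ℝ := ∫ x, ‖curl v x‖ ^ 2 with hZdef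
  set A : ℝ := ∫ x, frobeniusNormSq (fderiv ℝ (curl v) x) with hAdef
  set J : ℝ := ∫ x, ⟪curl v x, fderiv ℝ v x (curl v x)⟫ with hJdef
  have hZ0 : 0 ≤ Z := integral_nonneg fun x => sq_nonneg _
  have hA0 : 0 ≤ A := integral_nonneg fun x => frobeniusNormSq_nonneg _
  -- pointwise decomposition of the integrand
  have hfun : (fun x => ⟪curl v x, curl W x⟫) = fun x =>
      ν * ⟪(Δ (curl v)) x, curl v x⟫ - ⟪curl v x, fderiv ℝ (curl v) x (v x)⟫ +
        ⟪curl v x, fderiv ℝ v x (curl v x)⟫ := by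
    funext x
    have hc : ⟪curl v x, ν • (Δ (curl v)) x⟫ = ν * ⟪(Δ (curl v)) x, curl v x⟫ := by
      rw [real_inner_smul_right, real_inner_comm]
    rw [hZ x, inner_add_right, inner_sub_right, hc]
  have iAB : Integrable (fun x => ν * ⟪(Δ (curl v)) x, curl v x⟫ -
      ⟪curl v x, fderiv ℝ (curl v) x (v x)⟫) volume := (iLap.const_mul ν).sub iTr
  rw [hfun, integral_add iAB iStr, integral_sub (iLap.const_mul ν) iTr, integral_const_mul, hVisc,
    hTr, sub_zero]
  -- the local concentration credit: `J² ≤ M² Z (A − q)`, `q = (∫φ⟪v, curl ω⟫)²/E_φ ≤ ∫(v̂·curl ω)² ≤ A`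
  have hv3 : ContDiff ℝ 3 v := hv.of_le (by norm_cast)
  have isq : Integrable (fun x => ‖curl v x‖ ^ 2) volume :=
    integrable_sq_norm_of_lintegral_lt_top cω l2ω
  have hM0 : 0 ≤ M := (norm_nonneg (v 0)).trans (hM 0)
  set q : ℝ := (∫ x, φ x * ⟪v x, curl (curl v) x⟫) ^ 2 / ∫ x, φ x ^ 2 * ‖v x‖ ^ 2 with hqdef
  set G : ℝ := ∫ x, ⟪v x, curl (curl v) x⟫ ^ 2 / ‖v x‖ ^ 2 with hGdef
  have hdef := sq_integral_stretching_le_direction_defect hv2 hdiv hM isq iFrob iStr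
  rw [integral_norm_curl_curl_sq_eq hv3 isq iFrob] at hdef
  have hCS := sq_integral_mul_inner_curl_curl_le hv2 hM iFrob hφ hcφ
  -- `q ≤ G`
  have hG0 : 0 ≤ G := integral_nonneg fun x => by positivity
  have hqG : q ≤ G := by
    rcases eq_or_lt_of_le (integral_nonneg (fun x => by positivity) :
        (0 : ℝ) ≤ ∫ x, φ x ^ 2 * ‖v x‖ ^ 2) with hE0 | hEpos
    · rw [hqdef, ← hE0, div_zero]; exact hG0
    · rw [hqdef, div_le_iff₀ hEpos, mul_comm]; exact hCS
  -- `G ≤ A` (pointwise `⟪v,c⟫²/‖v‖² ≤ ‖c‖²`, and `‖curl ω‖₂ = ‖∇ω‖₂`)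
  have cc : Continuous (curl (curl v)) := continuous_curl hω1
  have meas_al : Measurable fun x => ⟪v x, curl (curl v) x⟫ ^ 2 / ‖v x‖ ^ 2 :=
    ((cv.inner cc).pow 2).measurable.div (cv.norm.pow 2).measurable
  have iW : Integrable (fun x => ‖curl (curl v) x‖ ^ 2) := integrable_norm_curl_curl_sq hv2 iFrob
  have hGA : G ≤ A := by
    have h1 : G ≤ ∫ x, ‖curl (curl v) x‖ ^ 2 := by
      refine integral_mono_of_nonneg (Eventually.of_forall fun x => by positivity) iW
        (Eventually.of_forall fun x => ?_)
      exact (inner_cross_sq_le_direction (a := curl v x) (c := curl (curl v) x) (hM x)).1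
    rw [integral_norm_curl_curl_sq_eq hv3 isq iFrob] at h1
    exact h1
  have hq0 : 0 ≤ q := by rw [hqdef]; positivity
  -- `J ≤ M √Z √(A − q)`
  set A' : ℝ := A - q with hA'
  have hA'0 : 0 ≤ A' := by rw [hA']; linarith
  have hMZ : 0 ≤ M ^ 2 * Z := mul_nonneg (sq_nonneg _) hZ0
  have hJ2 : J ^ 2 ≤ (M * Real.sqrt Z * Real.sqrt A') ^ 2 := by
    calc J ^ 2 ≤ M ^ 2 * Z * (A - G) := hdef
      _ ≤ M ^ 2 * Z * A' := by rw [hA']; exact mul_le_mul_of_nonneg_left (by linarith) hMZ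
      _ = (M * Real.sqrt Z * Real.sqrt A') ^ 2 := by
          rw [mul_pow, mul_pow, Real.sq_sqrt hZ0, Real.sq_sqrt hA'0]
  have hJle : J ≤ M * Real.sqrt Z * Real.sqrt A' := (abs_le_of_sq_le_sq' hJ2 (by positivity)).2
  -- Young on `A' = A − q`: `−ν(A' + q) + M z a ≤ M²z²/(4ν) − ν q`
  set z : ℝ := Real.sqrt Z with hzdef
  set a : ℝ := Real.sqrt A' with hadef
  have hz2 : z ^ 2 = Z := Real.sq_sqrt hZ0
  have ha2 : a ^ 2 = A' := Real.sq_sqrt hA'0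
  have hν4 : 0 < 4 * ν := by positivity
  have key : ν * -A' + M * z * a ≤ M ^ 2 / (4 * ν) * Z := by
    rw [← hz2, ← ha2, div_mul_eq_mul_div, le_div_iff₀ hν4]
    nlinarith [sq_nonneg (M * z - 2 * ν * a), hν]
  have hAA : A = A' + q := by rw [hA']; ring
  show ν * -A + J ≤ M ^ 2 / (4 * ν) * Z - ν * q
  rw [hAA]
  nlinarith [key, hJle]


end Summit.NavierStokesRegularity.NavierStokesRegularity.Theorems.DepletionLadder

end
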